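import Summits.HubbardSuperconductivity.HubbardSuperconductivity.Theorems.AnisotropyChordTransferFibre3Hole2Sound

/-!
# Route `AnisotropyChord` / H0 rotor rung: HOLE₂ per-`L` certificates — SOUNDNESS IV: aggregation and the real certificate inequality

Continuation of `…Fibre3Hole2Sound` for a pair `(0, (s₁,s₂))` of the kernel checker `…Fibre3Hole2Check`:
* `S2Z_cast`: the tabulated integer matrix is `S2 = 2D³·S_r`, `S_r = E_r + E_rᵀ − E_rᵀ X_r E_r − ½` (`E_r = eMat/D`, `X_r = X2/2D`);
* `quad_KZ`: AGGREGATION — for a real slot vector `w` that is point-determined (`w (repOf a) = w a`) and vanishes on the deleted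
  slots, `Σ_{p,q} w_p w_q K_pq = Σ_{a,b} w_a w_b S2_ab` (`K = Pᵀ S2 P`, `repOf_le`, `slotPt_repOf`, `sum_pInd`);
* ★ `real_cert`: if `K2 = K + Kᵀ` passes `psdCheck` then `½ Σ w² ≤ 2 Σ (E_r w)·w − (E_r w)ᵀ G (E_r w)` with the TRUE Green matrix
  `G_pq = Re G̃_{g_L}(pt p − pt q)` (via `psdCheck_sound` and the domination `quad_GR_le_XR` of `…Fibre3Hole2Sound`).
This is p2's Birman–Schwinger certificate inequality (`…Fibre3TwoHoleBS.MatrixCert`) for real boundary data; `…Fibre3Hole2Cert` turns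
it into `TwoHoleGapRealAt` / `TwoHoleGap`.
Prover seat `hubbard-h0-rotor-p3` g3; helper for stmt-HubbardSuperconductivity-19089 (`--supports`, helper class).
WHAT THIS IS NOT: nothing here proves superconductivity in the Hubbard model (rotor TARGET as worded stays FALSE, g15 verdict);
soundness lemmas for the per-`L` HOLE₂ certificates of ONE conditional reduction (rung 19089). Mathlib + tree imports only; no sorry.
-/

set_option linter.dupNamespace false
set_option autoImplicit false

namespace Summit.HubbardSuperconductivity.HubbardSuperconductivity.Theorems.AnisotropyChord.Transfer.Fibre3

namespace Hole2

open scoped BigOperators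
open Finset

section Pair

variable (L : ℕ) [NeZero L] (s1 s2 : ℕ) (G : List (List Iv)) (E : ℕ → ℕ → ℤ)

/-! ## The integer certificate matrices read in `ℝ` -/

/-- the tabulated integer matrix `S2` of the pair (from an interval Green matrix `G`). [folklore] -/
def S2Z : ℕ → ℕ → ℤ := tab 10 (s2Mat E (x2Mat G))

/-- the aggregated integer matrix `K` of the pair. [folklore] -/
def KZ : ℕ → ℕ → ℤ := kMat L s1 s2 (S2Z G E)

omit [NeZero L] in
/-- the checker's `k2Of` is `k2Mat (KZ … GI)` (definitional bookkeeping). [folklore] -/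
theorem k2Of_eq :
    k2Of L (cosTab L) (einvTab L (cosTab L) (gFix L)) s1 s2
      = k2Mat (KZ L s1 s2 (GI L s1 s2) (eMat L (GI L s1 s2) s1 s2)) := rfl

omit [NeZero L] in
/-- the triple product read in `ℝ`: `Σ E_r X_r E_r = (Σ E·X2·E)/(2D³)`. [folklore] -/
theorem sum_EXE_cast (p q : ℕ) :
    (∑ a ∈ range 10, ∑ b ∈ range 10, ER E a p * XR G a b * ER E b q)
      = (∑ a ∈ range 10, ∑ b ∈ range 10,
          ((E a p : ℤ) : ℝ) * ((x2Mat G a b : ℤ) : ℝ) * ((E b q : ℤ) : ℝ))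
        / (2 * ((D : ℤ) : ℝ) ^ 3) := by
  have hD := D_pos
  rw [Finset.sum_div]
  refine Finset.sum_congr rfl fun a _ => ?_
  rw [Finset.sum_div]
  refine Finset.sum_congr rfl fun b _ => ?_
  unfold ER XR
  field_simp

omit [NeZero L] in
/-- ★ `S2 = 2D³·S_r` on the range. [folklore] -/
theorem S2Z_cast {p q : ℕ} (hp : p < 10) (hq : q < 10) :
    ((S2Z G E p q : ℤ) : ℝ) = 2 * ((D : ℤ) : ℝ) ^ 3 * SR G E p q := by
  have hD := D_pos
  unfold S2Z
  rw [tab_eq 10 _ hp hq]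
  unfold s2Mat SR
  rw [sum_EXE_cast]
  unfold ER
  push_cast
  by_cases hpq : p = q
  · rw [if_pos hpq, if_pos hpq]; field_simp
  · rw [if_neg hpq, if_neg hpq]; field_simp; ring

/-! ## Aggregation onto representative live slots -/

omit [NeZero L] in
/-- the representative slot is not larger. [folklore] -/
theorem repOf_le (p : ℕ) : repOf L s1 s2 p ≤ p := by
  unfold repOf
  cases h : (List.range (p + 1)).find? (fun q => slotPt L s1 s2 q == slotPt L s1 s2 p) with
  | none => simp
  | some q =>
    have hq := List.mem_of_find?_eq_some h
    rw [List.mem_range] at hq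
    simp only [Option.getD_some]
    omega

omit [NeZero L] in
/-- the representative slot carries the same point. [folklore] -/
theorem slotPt_repOf (p : ℕ) : slotPt L s1 s2 (repOf L s1 s2 p) = slotPt L s1 s2 p := by
  unfold repOf
  cases h : (List.range (p + 1)).find? (fun q => slotPt L s1 s2 q == slotPt L s1 s2 p) with
  | none => simp
  | some q =>
    have hq := List.find?_some h
    simp only [Option.getD_some]
    simpa using hq

/-- the indicator of «slot `a` is live and represented by `p`». [folklore] -/
noncomputable def pInd (a p : ℕ) : ℝ := if repOf L s1 s2 a = p ∧ isHole L s1 s2 a = false then 1 else 0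

omit [NeZero L] in
/-- `K = Pᵀ S2 P` read in `ℝ`. [folklore] -/
theorem KZ_cast (p q : ℕ) :
    ((KZ L s1 s2 G E p q : ℤ) : ℝ)
      = ∑ a ∈ range 10, ∑ b ∈ range 10, pInd L s1 s2 a p * ((S2Z G E a b : ℤ) : ℝ) * pInd L s1 s2 b q := by
  unfold KZ kMat pInd
  push_cast
  refine Finset.sum_congr rfl fun a _ => Finset.sum_congr rfl fun b _ => ?_
  by_cases ha : repOf L s1 s2 a = p ∧ isHole L s1 s2 a = false <;>
    by_cases hb : repOf L s1 s2 b = q ∧ isHole L s1 s2 b = false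
  · rw [if_pos ⟨ha.1, hb.1, ha.2, hb.2⟩, if_pos ha, if_pos hb]; ring
  · rw [if_neg (fun h => hb ⟨h.2.1, h.2.2.2⟩), if_neg hb]; ring
  · rw [if_neg (fun h => ha ⟨h.1, h.2.2.1⟩), if_neg ha]; ring
  · rw [if_neg (fun h => ha ⟨h.1, h.2.2.1⟩), if_neg ha]; ring

omit [NeZero L] in
/-- for a point-determined slot vector vanishing on the holes, `Σ_p w_p P_{ap} = w_a`. [folklore] -/
theorem sum_pInd (w : ℕ → ℝ) (hrep : ∀ a, a < 10 → w (repOf L s1 s2 a) = w a)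
    (hhole : ∀ a, a < 10 → isHole L s1 s2 a = true → w a = 0) {a : ℕ} (ha : a < 10) :
    ∑ p ∈ range 10, w p * pInd L s1 s2 a p = w a := by
  unfold pInd
  by_cases hh : isHole L s1 s2 a = false
  · have e : ∀ p ∈ range 10, w p * (if repOf L s1 s2 a = p ∧ isHole L s1 s2 a = false then (1 : ℝ) else 0)
        = if repOf L s1 s2 a = p then w p else 0 := by
      intro p _
      by_cases h1 : repOf L s1 s2 a = p
      · rw [if_pos ⟨h1, hh⟩, if_pos h1, mul_one]
      · rw [if_neg (fun h => h1 h.1), if_neg h1, mul_zero]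
    rw [Finset.sum_congr rfl e, Finset.sum_ite_eq]
    have hmem : repOf L s1 s2 a ∈ range 10 := mem_range.mpr (lt_of_le_of_lt (repOf_le L s1 s2 a) ha)
    rw [if_pos hmem, hrep a ha]
  · have hh' : isHole L s1 s2 a = true := by simpa using hh
    rw [hhole a ha hh']
    refine Finset.sum_eq_zero fun p _ => ?_
    rw [if_neg (fun h => hh h.2), mul_zero]

omit [NeZero L] in
/-- ★ AGGREGATION: `Σ_{p,q} w_p w_q K_pq = Σ_{a,b} w_a w_b S2_ab` for point-determined `w` vanishing on the holes. [folklore] -/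
theorem quad_KZ (w : ℕ → ℝ) (hrep : ∀ a, a < 10 → w (repOf L s1 s2 a) = w a)
    (hhole : ∀ a, a < 10 → isHole L s1 s2 a = true → w a = 0) :
    (∑ p ∈ range 10, ∑ q ∈ range 10, w p * w q * ((KZ L s1 s2 G E p q : ℤ) : ℝ))
      = ∑ a ∈ range 10, ∑ b ∈ range 10, w a * w b * ((S2Z G E a b : ℤ) : ℝ) := by
  -- both sides equal the four-fold sum `Σ_{a,b,p,q} w_p P_ap S_ab P_bq w_q`
  have lhs : (∑ p ∈ range 10, ∑ q ∈ range 10, w p * w q * ((KZ L s1 s2 G E p q : ℤ) : ℝ))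
      = ∑ p ∈ range 10, ∑ q ∈ range 10, ∑ a ∈ range 10, ∑ b ∈ range 10,
          w p * pInd L s1 s2 a p * ((S2Z G E a b : ℤ) : ℝ) * (pInd L s1 s2 b q * w q) := by
    refine Finset.sum_congr rfl fun p _ => Finset.sum_congr rfl fun q _ => ?_
    rw [KZ_cast, Finset.mul_sum]
    refine Finset.sum_congr rfl fun a _ => ?_
    rw [Finset.mul_sum]
    exact Finset.sum_congr rfl fun b _ => by ring
  have rhs : (∑ a ∈ range 10, ∑ b ∈ range 10, w a * w b * ((S2Z G E a b : ℤ) : ℝ))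
      = ∑ a ∈ range 10, ∑ b ∈ range 10, ∑ p ∈ range 10, ∑ q ∈ range 10,
          w p * pInd L s1 s2 a p * ((S2Z G E a b : ℤ) : ℝ) * (pInd L s1 s2 b q * w q) := by
    refine Finset.sum_congr rfl fun a ha => Finset.sum_congr rfl fun b hb => ?_
    rw [← sum_pInd L s1 s2 w hrep hhole (mem_range.mp ha), ← sum_pInd L s1 s2 w hrep hhole (mem_range.mp hb)]
    rw [Finset.sum_mul, Finset.sum_mul]
    refine Finset.sum_congr rfl fun p _ => ?_
    rw [Finset.mul_sum, Finset.sum_mul]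
    exact Finset.sum_congr rfl fun q _ => by ring
  rw [lhs, rhs]
  -- reorder the four sums
  calc (∑ p ∈ range 10, ∑ q ∈ range 10, ∑ a ∈ range 10, ∑ b ∈ range 10,
          w p * pInd L s1 s2 a p * ((S2Z G E a b : ℤ) : ℝ) * (pInd L s1 s2 b q * w q))
      = ∑ p ∈ range 10, ∑ a ∈ range 10, ∑ q ∈ range 10, ∑ b ∈ range 10,
          w p * pInd L s1 s2 a p * ((S2Z G E a b : ℤ) : ℝ) * (pInd L s1 s2 b q * w q) :=
        Finset.sum_congr rfl fun p _ => Finset.sum_comm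
    _ = ∑ a ∈ range 10, ∑ p ∈ range 10, ∑ q ∈ range 10, ∑ b ∈ range 10,
          w p * pInd L s1 s2 a p * ((S2Z G E a b : ℤ) : ℝ) * (pInd L s1 s2 b q * w q) := Finset.sum_comm
    _ = ∑ a ∈ range 10, ∑ p ∈ range 10, ∑ b ∈ range 10, ∑ q ∈ range 10,
          w p * pInd L s1 s2 a p * ((S2Z G E a b : ℤ) : ℝ) * (pInd L s1 s2 b q * w q) :=
        Finset.sum_congr rfl fun a _ => Finset.sum_congr rfl fun p _ => Finset.sum_comm
    _ = ∑ a ∈ range 10, ∑ b ∈ range 10, ∑ p ∈ range 10, ∑ q ∈ range 10,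
          w p * pInd L s1 s2 a p * ((S2Z G E a b : ℤ) : ℝ) * (pInd L s1 s2 b q * w q) :=
        Finset.sum_congr rfl fun a _ => Finset.sum_comm

/-! ## The real certificate inequality -/

omit [NeZero L] in
/-- `K2` is symmetric. [folklore] -/
theorem k2Mat_symm (K : ℕ → ℕ → ℤ) (i j : ℕ) : k2Mat K i j = k2Mat K j i := by
  unfold k2Mat; push_cast; ring

/-- ★ THE REAL CERTIFICATE INEQUALITY: for the pair `(0, (s₁,s₂))` whose `K2` passes `psdCheck`, every point-determined real slot
vector `w` vanishing on the holes satisfies `½ Σ w² ≤ 2 Σ (E_r w)·w − (E_r w)ᵀ G (E_r w)` with the TRUE Green matrix `G`. [folklore] -/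
theorem real_cert (hG : GEncl L s1 s2 G) (hpsd : psdCheck 10 (k2Mat (KZ L s1 s2 G E)) = true)
    (w : ℕ → ℝ) (hrep : ∀ a, a < 10 → w (repOf L s1 s2 a) = w a)
    (hhole : ∀ a, a < 10 → isHole L s1 s2 a = true → w a = 0) :
    (1 / 2 : ℝ) * ∑ p ∈ range 10, w p ^ 2
      ≤ 2 * (∑ p ∈ range 10, (∑ q ∈ range 10, ER E p q * w q) * w p)
        - ∑ p ∈ range 10, ∑ q ∈ range 10,
            (∑ t ∈ range 10, ER E p t * w t) * GR L s1 s2 p q * (∑ t ∈ range 10, ER E q t * w t) := by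
  have hD := D_pos
  set v : ℕ → ℝ := fun p => ∑ t ∈ range 10, ER E p t * w t with hv
  -- positivity of the aggregate
  have h0 := psdCheck_sound 10 (k2Mat (KZ L s1 s2 G E)) (fun i j _ _ => k2Mat_symm (KZ L s1 s2 G E) i j) hpsd w
  have h1 : qf 10 (k2Mat (KZ L s1 s2 G E)) w = 2 * ∑ p ∈ range 10, ∑ q ∈ range 10, w p * w q * ((KZ L s1 s2 G E p q : ℤ) : ℝ) := by
    unfold qf k2Mat
    push_cast
    have e : ∑ p ∈ range 10, ∑ q ∈ range 10, w p * w q * ((KZ L s1 s2 G E q p : ℤ) : ℝ)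
        = ∑ p ∈ range 10, ∑ q ∈ range 10, w p * w q * ((KZ L s1 s2 G E p q : ℤ) : ℝ) := by
      rw [Finset.sum_comm]
      exact Finset.sum_congr rfl fun p _ => Finset.sum_congr rfl fun q _ => by ring
    have split : (∑ p ∈ range 10, ∑ q ∈ range 10, w p * w q * (((KZ L s1 s2 G E p q : ℤ) : ℝ) + ((KZ L s1 s2 G E q p : ℤ) : ℝ)))
        = (∑ p ∈ range 10, ∑ q ∈ range 10, w p * w q * ((KZ L s1 s2 G E p q : ℤ) : ℝ))
          + ∑ p ∈ range 10, ∑ q ∈ range 10, w p * w q * ((KZ L s1 s2 G E q p : ℤ) : ℝ) := by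
      rw [← Finset.sum_add_distrib]
      refine Finset.sum_congr rfl fun p _ => ?_
      rw [← Finset.sum_add_distrib]
      exact Finset.sum_congr rfl fun q _ => by ring
    rw [split, e]
    ring
  rw [h1, quad_KZ L s1 s2 G E w hrep hhole] at h0
  have h2 : (∑ a ∈ range 10, ∑ b ∈ range 10, w a * w b * ((S2Z G E a b : ℤ) : ℝ))
      = 2 * ((D : ℤ) : ℝ) ^ 3 * ∑ a ∈ range 10, ∑ b ∈ range 10, w a * w b * SR G E a b := by
    rw [Finset.mul_sum]
    refine Finset.sum_congr rfl fun a ha => ?_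
    rw [Finset.mul_sum]
    refine Finset.sum_congr rfl fun b hb => ?_
    rw [S2Z_cast G E (mem_range.mp ha) (mem_range.mp hb)]
    ring
  rw [h2] at h0
  have h3 : 0 ≤ ∑ a ∈ range 10, ∑ b ∈ range 10, w a * w b * SR G E a b := by
    have hD3 : 0 < 2 * (2 * ((D : ℤ) : ℝ) ^ 3) := by positivity
    rw [← mul_assoc] at h0
    exact (mul_nonneg_iff_of_pos_left hD3).mp h0
  -- expand `Σ w w S_r`
  have eE : ∑ a ∈ range 10, ∑ b ∈ range 10, w a * w b * ER E a b = ∑ a ∈ range 10, v a * w a := by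
    refine Finset.sum_congr rfl fun a _ => ?_
    rw [hv]; simp only []
    rw [Finset.sum_mul]
    exact Finset.sum_congr rfl fun b _ => by ring
  have eEt : ∑ a ∈ range 10, ∑ b ∈ range 10, w a * w b * ER E b a = ∑ b ∈ range 10, v b * w b := by
    rw [Finset.sum_comm]
    refine Finset.sum_congr rfl fun b _ => ?_
    rw [hv]; simp only []
    rw [Finset.sum_mul]
    exact Finset.sum_congr rfl fun a _ => by ring
  have eX : ∑ a ∈ range 10, ∑ b ∈ range 10,
      w a * w b * (∑ c ∈ range 10, ∑ d ∈ range 10, ER E c a * XR G c d * ER E d b)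
      = ∑ c ∈ range 10, ∑ d ∈ range 10, v c * XR G c d * v d := by
    -- four-fold sum both ways
    have l1 : ∑ a ∈ range 10, ∑ b ∈ range 10,
        w a * w b * (∑ c ∈ range 10, ∑ d ∈ range 10, ER E c a * XR G c d * ER E d b)
        = ∑ a ∈ range 10, ∑ b ∈ range 10, ∑ c ∈ range 10, ∑ d ∈ range 10,
            (ER E c a * w a) * XR G c d * (ER E d b * w b) := by
      refine Finset.sum_congr rfl fun a _ => Finset.sum_congr rfl fun b _ => ?_
      rw [Finset.mul_sum]
      refine Finset.sum_congr rfl fun c _ => ?_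
      rw [Finset.mul_sum]
      exact Finset.sum_congr rfl fun d _ => by ring
    have r1 : ∑ c ∈ range 10, ∑ d ∈ range 10, v c * XR G c d * v d
        = ∑ c ∈ range 10, ∑ d ∈ range 10, ∑ a ∈ range 10, ∑ b ∈ range 10,
            (ER E c a * w a) * XR G c d * (ER E d b * w b) := by
      refine Finset.sum_congr rfl fun c _ => Finset.sum_congr rfl fun d _ => ?_
      rw [hv]; simp only []
      rw [Finset.sum_mul, Finset.sum_mul]
      refine Finset.sum_congr rfl fun a _ => ?_
      rw [Finset.mul_sum]
    rw [l1, r1]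
    calc (∑ a ∈ range 10, ∑ b ∈ range 10, ∑ c ∈ range 10, ∑ d ∈ range 10,
            (ER E c a * w a) * XR G c d * (ER E d b * w b))
        = ∑ a ∈ range 10, ∑ c ∈ range 10, ∑ b ∈ range 10, ∑ d ∈ range 10,
            (ER E c a * w a) * XR G c d * (ER E d b * w b) :=
          Finset.sum_congr rfl fun a _ => Finset.sum_comm
      _ = ∑ c ∈ range 10, ∑ a ∈ range 10, ∑ b ∈ range 10, ∑ d ∈ range 10,
            (ER E c a * w a) * XR G c d * (ER E d b * w b) := Finset.sum_comm
      _ = ∑ c ∈ range 10, ∑ a ∈ range 10, ∑ d ∈ range 10, ∑ b ∈ range 10,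
            (ER E c a * w a) * XR G c d * (ER E d b * w b) :=
          Finset.sum_congr rfl fun c _ => Finset.sum_congr rfl fun a _ => Finset.sum_comm
      _ = ∑ c ∈ range 10, ∑ d ∈ range 10, ∑ a ∈ range 10, ∑ b ∈ range 10,
            (ER E c a * w a) * XR G c d * (ER E d b * w b) :=
          Finset.sum_congr rfl fun c _ => Finset.sum_comm
  have eI : ∑ a ∈ range 10, ∑ b ∈ range 10, w a * w b * (if a = b then (1 : ℝ) / 2 else 0)
      = (1 / 2 : ℝ) * ∑ a ∈ range 10, w a ^ 2 := by
    rw [Finset.mul_sum]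
    refine Finset.sum_congr rfl fun a ha => ?_
    have e : ∀ b ∈ range 10, w a * w b * (if a = b then (1 : ℝ) / 2 else 0) = if a = b then w a * w b * (1 / 2) else 0 := by
      intro b _; split_ifs <;> ring
    rw [Finset.sum_congr rfl e, Finset.sum_ite_eq, if_pos ha]
    ring
  have hsum : ∑ a ∈ range 10, ∑ b ∈ range 10, w a * w b * SR G E a b
      = 2 * (∑ a ∈ range 10, v a * w a) - (∑ c ∈ range 10, ∑ d ∈ range 10, v c * XR G c d * v d)
        - (1 / 2 : ℝ) * ∑ a ∈ range 10, w a ^ 2 := by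
    unfold SR
    simp only [mul_sub, mul_add, Finset.sum_sub_distrib, Finset.sum_add_distrib]
    rw [eE, eEt, eX, eI]
    ring
  rw [hsum] at h3
  have h4 := quad_GR_le_XR L s1 s2 G hG v
  linarith

end Pair

end Hole2

end Summit.HubbardSuperconductivity.HubbardSuperconductivity.Theorems.AnisotropyChord.Transfer.Fibre3
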